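import Mathlib
import Summits.PneNP.PneNP.Theorems.ConvexRankGatesConvexGateBlindColumnSpaceBlind
import Summits.PneNP.PneNP.Theorems.ConvexRankGatesConvexGateBlindCatchTwo

/-!
# PneNP / ConvexRankGates — `ConvexGateBlind`: the column-space LP slice for every `δ < 1/5`

Helpers (`--supports stmt-PneNP-10680`), COLUMN-SPACE line (prover seat 2, session 16): the eventual form of the
second-generation catch bound `…CatchTwo.card_badColourings_le_two`.

* `restricted_terms_lower_bound_of_catch` — the counting step of `…ColumnSpaceBlind.restricted_terms_lower_bound` with an
  ABSTRACT catch bound `θ`: if every `k`-clique-non-negative weighting catches at most `q^m·θ` colourings, a restricted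
  factorisation with `R` terms has `q^m − q ≤ R·q^m·θ`.
* `eventually_pow_mul_exp_le` — `m^c · e^{−E} ≤ a` eventually, uniformly in `E ≥ m^γ/C` (`γ > 0`).
* `eventually_catch_exponent_two` — with `k = ⌈m^δ⌉₊`, `δ < 1/5`: eventually `m^c · θ₂(m,k) ≤ 1/4`, where
  `θ₂ = exp(−(m−1)/(9216kL²)) + exp(−1/(5200√β))` (`kL² ≤ 4k⁵ ≤ 2⁷m^{5δ}` and `β ≤ k³/m`).
* `columnSpace_cliqueDistConeRankHard_fifth` (stub `columnSpace_crux_fifth`) — THE COLUMN-SPACE LP SLICE OF THE CRUX HOLDS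
  FOR EVERY `δ ∈ (0, 1/5)` and every `c`: eventually in `m`, for every `ε > 0`, no identity
  `cdist Q u − ε = ∑_{l<R} b_l(u)·t_l(E(Q))` with `R ≤ m^c`, `b ≥ 0` and `k`-clique-non-negative `t_l` holds on all `k`-sets
  `Q` and all `k`-clique-free `u` (session 13: `δ < 1/11`).
[new]
-/

set_option linter.dupNamespace false

namespace Summit.PneNP.PneNP.Theorems

open Finset Real Filter Literature.Computability.Complexity
open Summit.PneNP.PneNP.Cruxes.ConvexGateBlind.StrictRankConicCover (Edge cdist)

noncomputable section

/-! ## Counting with an abstract catch bound -/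

/-- **Restricted factorisations have many terms (abstract catch bound).** Let `3 ≤ k`, `k + 2 ≤ m`, `ε > 0`, `b ≥ 0`,
`k`-clique-non-negative `t₁,…,t_R` with `cdist Q u − ε = ∑_l b_l(u)·t_l(E(Q))` for all `k`-sets `Q` and `k`-clique-free `u`,
and suppose every `k`-clique-non-negative weighting catches at most `(k−1)^m·θ` colourings. Then
`(k−1)^m − (k−1) ≤ R·((k−1)^m·θ)`. [new] -/
theorem restricted_terms_lower_bound_of_catch {m k R : ℕ} (hk : 3 ≤ k) (hm : k + 2 ≤ m)
    (t : Fin R → Edge m → ℝ) (ht : ∀ l (Q : Finset (Fin m)), Q.card = k → 0 ≤ ∑ e, if cliqueVec Q e = true then t l e else 0)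
    (b : (Edge m → Bool) → Fin R → ℝ) (hb : ∀ u l, 0 ≤ b u l) (ε : ℝ) (hε : 0 < ε)
    (hfact : ∀ (Q : Finset (Fin m)) (u : Edge m → Bool), Q.card = k → cliqueFn m k u = false →
      cdist Q u - ε = ∑ l, b u l * ∑ e, (if cliqueVec Q e = true then t l e else 0))
    (θ : ℝ) (hcatch : ∀ w : Edge m → ℝ, (∀ Q ∈ (Finset.univ : Finset (Fin m)).powersetCard k, 0 ≤ softWindow w Q) →
      ((((Finset.univ : Finset (Fin m → Fin (k - 1))).filter fun c =>
        ∑ e, (if colorVec c e = true then w e else 0) < 0).card : ℝ)) ≤ ((k - 1 : ℕ) : ℝ) ^ m * θ) :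
    ((k - 1 : ℕ) : ℝ) ^ m - ((k - 1 : ℕ) : ℝ) ≤ R * (((k - 1 : ℕ) : ℝ) ^ m * θ) := by
  classical
  obtain ⟨μ, Λ, hμ, -, hneg, -⟩ := negCover_of_restrictedFactorisation (by omega) hm t b hb ε hε
    (fun Q u hQ hu => by rw [← hfact Q u hQ hu]; rfl)
  set BAD : Fin R → Finset (Fin m → Fin (k - 1)) := fun l =>
    (Finset.univ : Finset (Fin m → Fin (k - 1))).filter fun c => ∑ e, (if colorVec c e = true then t l e else 0) < 0
    with hBAD
  have hcover : ((Finset.univ : Finset (Fin m → Fin (k - 1))).filter fun c => ∃ x y, c x ≠ c y) ⊆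
      (Finset.univ : Finset (Fin R)).biUnion BAD := by
    intro c hc
    rw [Finset.mem_filter] at hc
    have hcf : cliqueFn m k (colorVec c) = false := cliqueFn_colorVec c (by omega)
    obtain ⟨j, hj⟩ := exists_neg_sum_of_negCover t (μ (colorVec c)) (hμ (colorVec c)) (colorVec c)
      (exists_colorVec_eq_true c hc.2) (hneg (colorVec c) hcf)
    exact Finset.mem_biUnion.2 ⟨j, Finset.mem_univ _, Finset.mem_filter.2 ⟨Finset.mem_univ _, hj⟩⟩
  have hcatch' : ∀ l : Fin R, ((BAD l).card : ℝ) ≤ ((k - 1 : ℕ) : ℝ) ^ m * θ := by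
    intro l
    refine hcatch (t l) fun Q hQ => ?_
    rw [← sum_ite_cliqueVec_eq_softWindow]
    exact ht l Q (Finset.mem_powersetCard.1 hQ).2
  have hnc := card_filter_nonconstant_ge (K := k - 1) (show 0 < m by omega)
  have h1 : (((Finset.univ : Finset (Fin m → Fin (k - 1))).filter fun c => ∃ x y, c x ≠ c y).card : ℝ) ≤
      ∑ l : Fin R, ((BAD l).card : ℝ) := by
    have := (Finset.card_le_card hcover).trans Finset.card_biUnion_le
    exact_mod_cast this
  have h2 : ∑ l : Fin R, ((BAD l).card : ℝ) ≤ R * (((k - 1 : ℕ) : ℝ) ^ m * θ) := by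
    calc ∑ l : Fin R, ((BAD l).card : ℝ) ≤ ∑ _l : Fin R, ((k - 1 : ℕ) : ℝ) ^ m * θ := Finset.sum_le_sum fun l _ => hcatch' l
      _ = _ := by rw [Finset.sum_const, Finset.card_univ, Fintype.card_fin, nsmul_eq_mul]
  have h0 : (((k - 1 : ℕ) : ℝ)) ^ m ≤
      (((Finset.univ : Finset (Fin m → Fin (k - 1))).filter fun c => ∃ x y, c x ≠ c y).card : ℝ) + ((k - 1 : ℕ) : ℝ) := by
    exact_mod_cast hnc
  linarith

/-! ## The two-term catch exponent is eventually large -/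

/-- **Polynomials lose against stretched exponentials, uniformly.** For `γ, C, a > 0` and `c : ℕ`: eventually in `m`, every
`E ≥ m^γ/C` has `m^c · e^{−E} ≤ a`. [folklore] -/
theorem eventually_pow_mul_exp_le {γ C a : ℝ} (hγ : 0 < γ) (hC : 0 < C) (ha : 0 < a) (c : ℕ) :
    ∀ᶠ m : ℕ in atTop, ∀ E : ℝ, (m : ℝ) ^ γ / C ≤ E → (m : ℝ) ^ c * Real.exp (-E) ≤ a := by
  set n : ℕ := ⌈((c : ℝ) + 1) / γ⌉₊ with hn
  have hγn : (c : ℝ) + 1 ≤ γ * n := by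
    have h := Nat.le_ceil (((c : ℝ) + 1) / γ)
    rw [← hn] at h
    rw [div_le_iff₀ hγ] at h
    linarith
  set C₀ : ℝ := C ^ n * (n.factorial : ℝ) / a with hC₀
  have hC₀pos : 0 < C₀ := by rw [hC₀]; positivity
  filter_upwards [eventually_ge_atTop ⌈C₀⌉₊, eventually_ge_atTop 1] with m hmC hm1
  intro E hE
  have hm0 : (0 : ℝ) < m := by exact_mod_cast (show 0 < m by omega)
  have hmC' : C₀ ≤ m := (Nat.le_ceil C₀).trans (by exact_mod_cast hmC)
  have hEpos : 0 ≤ (m : ℝ) ^ γ / C := by positivity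
  -- `exp E ≥ m^{c+1} / (C^n n!)`
  have hexp : (m : ℝ) ^ (c + 1) / (C ^ n * n.factorial) ≤ Real.exp E := by
    have h1 : ((m : ℝ) ^ γ / C) ^ n / n.factorial ≤ Real.exp ((m : ℝ) ^ γ / C) :=
      Real.pow_div_factorial_le_exp _ hEpos n
    have h2 : Real.exp ((m : ℝ) ^ γ / C) ≤ Real.exp E := Real.exp_le_exp.2 hE
    have h3 : (m : ℝ) ^ (c + 1) ≤ ((m : ℝ) ^ γ) ^ n := by
      rw [← Real.rpow_natCast ((m : ℝ) ^ γ) n, ← Real.rpow_mul hm0.le, ← Real.rpow_natCast (m : ℝ) (c + 1)]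
      refine Real.rpow_le_rpow_of_exponent_le (by exact_mod_cast hm1) ?_
      push_cast
      exact hγn
    calc (m : ℝ) ^ (c + 1) / (C ^ n * n.factorial) ≤ ((m : ℝ) ^ γ) ^ n / (C ^ n * n.factorial) :=
          div_le_div_of_nonneg_right h3 (by positivity)
      _ = ((m : ℝ) ^ γ / C) ^ n / n.factorial := by rw [div_pow]; field_simp
      _ ≤ Real.exp E := h1.trans h2
  have hexppos : 0 < Real.exp E := Real.exp_pos _
  rw [Real.exp_neg, ← div_eq_mul_inv, div_le_iff₀ hexppos]
  have hden : 0 < C ^ n * (n.factorial : ℝ) := by positivity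
  calc (m : ℝ) ^ c = ((m : ℝ) ^ (c + 1) / (C ^ n * n.factorial)) * ((C ^ n * n.factorial) / m) := by
        field_simp; ring
    _ ≤ Real.exp E * ((C ^ n * n.factorial) / m) := mul_le_mul_of_nonneg_right hexp (by positivity)
    _ ≤ Real.exp E * a := by
        refine mul_le_mul_of_nonneg_left ?_ hexppos.le
        rw [div_le_iff₀ hm0]
        rw [hC₀, div_le_iff₀ ha] at hmC'
        linarith
    _ = a * Real.exp E := by ring

/-- **The two-term catch exponent beats every polynomial (`δ < 1/5`).** With `k = ⌈m^δ⌉₊`: eventually `4 ≤ k`, `4k ≤ m` and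
`m^c · (exp(−(m−1)/(9216kL²)) + exp(−1/(5200√β))) ≤ 1/4`, `L = 2k²−4k+1`, `β = C(k,2)(k−2)/(m−k)`.
(`kL² ≤ 4k⁵ ≤ 2⁷ m^{5δ}` gives the first exponent `≥ m^{1−5δ}/2²²`; `β ≤ k³/m` gives the second `≥ m^{(1−3δ)/2}/2¹⁴`.) [new] -/
theorem eventually_catch_exponent_two {δ : ℝ} (hδ0 : 0 < δ) (hδ1 : δ < 1 / 5) (c : ℕ) :
    ∀ᶠ m : ℕ in atTop, 4 ≤ ⌈(m : ℝ) ^ δ⌉₊ ∧ 4 * ⌈(m : ℝ) ^ δ⌉₊ ≤ m ∧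
      (m : ℝ) ^ c * (Real.exp (-(((m : ℝ) - 1) / (9216 * ⌈(m : ℝ) ^ δ⌉₊ *
          (2 * (⌈(m : ℝ) ^ δ⌉₊ : ℝ) ^ 2 - 4 * ⌈(m : ℝ) ^ δ⌉₊ + 1) ^ 2))) +
        Real.exp (-(1 / (5200 * Real.sqrt (((⌈(m : ℝ) ^ δ⌉₊ : ℝ) * (⌈(m : ℝ) ^ δ⌉₊ - 1) / 2) *
          ((⌈(m : ℝ) ^ δ⌉₊ - 2) / (m - ⌈(m : ℝ) ^ δ⌉₊))))))) ≤ 1 / 4 := by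
  set γ₁ : ℝ := 1 - 5 * δ with hγ₁
  set γ₂ : ℝ := (1 - 3 * δ) / 2 with hγ₂
  have hγ₁0 : 0 < γ₁ := by rw [hγ₁]; linarith
  have hγ₂0 : 0 < γ₂ := by rw [hγ₂]; linarith
  filter_upwards [eventually_ceil_rpow_ge_and_mul_le hδ0 (by linarith) 4,
    eventually_pow_mul_exp_le hγ₁0 (by norm_num : (0 : ℝ) < 2 ^ 22) (by norm_num : (0 : ℝ) < 1 / 8) c,
    eventually_pow_mul_exp_le hγ₂0 (by norm_num : (0 : ℝ) < 2 ^ 14) (by norm_num : (0 : ℝ) < 1 / 8) c,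
    eventually_ge_atTop 2] with m hm4 hE1 hE2 hm2
  obtain ⟨hk4, hkm⟩ := hm4
  refine ⟨hk4, hkm, ?_⟩
  set k : ℕ := ⌈(m : ℝ) ^ δ⌉₊ with hk
  have hK4 : (4 : ℝ) ≤ k := by exact_mod_cast hk4
  have hKm : 4 * (k : ℝ) ≤ m := by exact_mod_cast hkm
  have hm2R : (2 : ℝ) ≤ m := by exact_mod_cast hm2
  have hm0 : (0 : ℝ) < m := by linarith
  have hm1 : (1 : ℝ) ≤ m := by linarith
  have hxge1 : (1 : ℝ) ≤ (m : ℝ) ^ δ := Real.one_le_rpow hm1 hδ0.le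
  have hK2 : (k : ℝ) ≤ 2 * (m : ℝ) ^ δ := by
    have := Nat.ceil_lt_add_one (by positivity : (0 : ℝ) ≤ (m : ℝ) ^ δ)
    rw [← hk] at this
    linarith
  set L : ℝ := 2 * (k : ℝ) ^ 2 - 4 * k + 1 with hL
  set β : ℝ := ((k : ℝ) * (k - 1) / 2) * (((k : ℝ) - 2) / ((m : ℝ) - k)) with hβ
  have hmk : (0 : ℝ) < (m : ℝ) - k := by linarith
  have hL0 : 0 < L := by rw [hL]; nlinarith
  have hLle : L ≤ 2 * (k : ℝ) ^ 2 := by rw [hL]; nlinarith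
  have hβ0 : 0 < β := by rw [hβ]; exact mul_pos (by nlinarith) (div_pos (by linarith) hmk)
  have hβle : β ≤ (k : ℝ) ^ 3 / m := by
    rw [hβ]
    have h1 : (k : ℝ) * (k - 1) / 2 ≤ (k : ℝ) ^ 2 / 2 := by nlinarith
    have h2 : ((k : ℝ) - 2) / ((m : ℝ) - k) ≤ 2 * k / m := by
      rw [div_le_div_iff₀ hmk hm0]; nlinarith
    calc (k : ℝ) * (k - 1) / 2 * (((k : ℝ) - 2) / ((m : ℝ) - k)) ≤ (k : ℝ) ^ 2 / 2 * (2 * k / m) :=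
          mul_le_mul h1 h2 (div_pos (by linarith) hmk).le (by positivity)
      _ = (k : ℝ) ^ 3 / m := by field_simp
  -- powers of `k` against powers of `m`
  have hK5 : (k : ℝ) ^ 5 ≤ 2 ^ 5 * (m : ℝ) ^ (5 * δ) := by
    calc (k : ℝ) ^ 5 ≤ (2 * (m : ℝ) ^ δ) ^ 5 := pow_le_pow_left₀ (by positivity) hK2 5
      _ = 2 ^ 5 * ((m : ℝ) ^ δ) ^ 5 := by rw [mul_pow]
      _ = 2 ^ 5 * (m : ℝ) ^ (5 * δ) := by
          have e3 : δ * ((5 : ℕ) : ℝ) = 5 * δ := by push_cast; ring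
          rw [← Real.rpow_natCast ((m : ℝ) ^ δ) 5, ← Real.rpow_mul hm0.le, e3]
  have hK3 : (k : ℝ) ^ 3 ≤ 2 ^ 3 * (m : ℝ) ^ (3 * δ) := by
    calc (k : ℝ) ^ 3 ≤ (2 * (m : ℝ) ^ δ) ^ 3 := pow_le_pow_left₀ (by positivity) hK2 3
      _ = 2 ^ 3 * ((m : ℝ) ^ δ) ^ 3 := by rw [mul_pow]
      _ = 2 ^ 3 * (m : ℝ) ^ (3 * δ) := by
          have e3 : δ * ((3 : ℕ) : ℝ) = 3 * δ := by push_cast; ring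
          rw [← Real.rpow_natCast ((m : ℝ) ^ δ) 3, ← Real.rpow_mul hm0.le, e3]
  -- FIRST TERM: `E₁ = (m-1)/(9216 k L²) ≥ m^{γ₁}/2^22`
  set E₁ : ℝ := ((m : ℝ) - 1) / (9216 * k * L ^ 2) with hE₁
  have hE₁ge : (m : ℝ) ^ γ₁ / 2 ^ 22 ≤ E₁ := by
    have hden : 0 < 9216 * (k : ℝ) * L ^ 2 := by positivity
    rw [hE₁, div_le_div_iff₀ (by positivity) hden]
    -- `m^{γ₁} · 9216 k L² ≤ 2^22 (m - 1)`: `k L² ≤ 4 k⁵ ≤ 2⁷ m^{5δ}`, `m^{γ₁} m^{5δ} = m`, `m ≤ 2(m-1)`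
    have hkL : (k : ℝ) * L ^ 2 ≤ 2 ^ 7 * (m : ℝ) ^ (5 * δ) := by
      calc (k : ℝ) * L ^ 2 ≤ (k : ℝ) * (2 * (k : ℝ) ^ 2) ^ 2 :=
            mul_le_mul_of_nonneg_left (pow_le_pow_left₀ hL0.le hLle 2) (by positivity)
        _ = 4 * (k : ℝ) ^ 5 := by ring
        _ ≤ 4 * (2 ^ 5 * (m : ℝ) ^ (5 * δ)) := by linarith
        _ = 2 ^ 7 * (m : ℝ) ^ (5 * δ) := by ring
    have hprod : (m : ℝ) ^ γ₁ * (m : ℝ) ^ (5 * δ) = m := by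
      rw [← Real.rpow_add hm0, hγ₁]
      have : (1 - 5 * δ + 5 * δ : ℝ) = 1 := by ring
      rw [this, Real.rpow_one]
    have hmγ0 : 0 ≤ (m : ℝ) ^ γ₁ := by positivity
    calc (m : ℝ) ^ γ₁ * (9216 * k * L ^ 2) = 9216 * ((m : ℝ) ^ γ₁ * ((k : ℝ) * L ^ 2)) := by ring
      _ ≤ 9216 * ((m : ℝ) ^ γ₁ * (2 ^ 7 * (m : ℝ) ^ (5 * δ))) :=
          mul_le_mul_of_nonneg_left (mul_le_mul_of_nonneg_left hkL hmγ0) (by norm_num)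
      _ = 9216 * 2 ^ 7 * ((m : ℝ) ^ γ₁ * (m : ℝ) ^ (5 * δ)) := by ring
      _ = 9216 * 2 ^ 7 * m := by rw [hprod]
      _ ≤ ((m : ℝ) - 1) * 2 ^ 22 := by linarith
  have hT1 : (m : ℝ) ^ c * Real.exp (-E₁) ≤ 1 / 8 := hE1 E₁ hE₁ge
  -- SECOND TERM: `E₂ = 1/(5200 √β) ≥ m^{γ₂}/2^14`
  set D₂ : ℝ := 5200 * Real.sqrt β with hD₂
  have hsqβ : 0 < Real.sqrt β := Real.sqrt_pos.2 hβ0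
  have hD₂0 : 0 < D₂ := by rw [hD₂]; positivity
  have hD₂sq : D₂ ^ 2 ≤ (2 ^ 14 * (m : ℝ) ^ (-γ₂)) ^ 2 := by
    have hsq : D₂ ^ 2 = 5200 ^ 2 * β := by rw [hD₂, mul_pow, Real.sq_sqrt hβ0.le]
    have hrhs : (2 ^ 14 * (m : ℝ) ^ (-γ₂)) ^ 2 = 2 ^ 28 * (m : ℝ) ^ (3 * δ - 1) := by
      have e1 : ((2 : ℝ) ^ 14) ^ 2 = 2 ^ 28 := by norm_num
      have e2 : -γ₂ * ((2 : ℕ) : ℝ) = 3 * δ - 1 := by rw [hγ₂]; push_cast; ring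
      rw [mul_pow, ← Real.rpow_natCast ((m : ℝ) ^ (-γ₂)) 2, ← Real.rpow_mul hm0.le, e1, e2]
    rw [hsq, hrhs]
    calc (5200 : ℝ) ^ 2 * β ≤ 5200 ^ 2 * ((k : ℝ) ^ 3 / m) := mul_le_mul_of_nonneg_left hβle (by positivity)
      _ ≤ 5200 ^ 2 * (2 ^ 3 * (m : ℝ) ^ (3 * δ) / m) := by gcongr
      _ = 5200 ^ 2 * 2 ^ 3 * (m : ℝ) ^ (3 * δ - 1) := by
          rw [Real.rpow_sub_one hm0.ne']
          ring
      _ ≤ 2 ^ 28 * (m : ℝ) ^ (3 * δ - 1) := by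
          have : (0 : ℝ) ≤ (m : ℝ) ^ (3 * δ - 1) := by positivity
          nlinarith
  have hD₂le : D₂ ≤ 2 ^ 14 * (m : ℝ) ^ (-γ₂) :=
    (pow_le_pow_iff_left₀ hD₂0.le (by positivity) two_ne_zero).1 hD₂sq
  have hE₂ge : (m : ℝ) ^ γ₂ / 2 ^ 14 ≤ 1 / D₂ := by
    rw [div_le_div_iff₀ (by positivity) hD₂0]
    calc (m : ℝ) ^ γ₂ * D₂ ≤ (m : ℝ) ^ γ₂ * (2 ^ 14 * (m : ℝ) ^ (-γ₂)) := mul_le_mul_of_nonneg_left hD₂le (by positivity)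
      _ = 1 * 2 ^ 14 := by
          rw [Real.rpow_neg hm0.le, mul_comm (2 ^ 14 : ℝ), ← mul_assoc,
            mul_inv_cancel₀ (Real.rpow_pos_of_pos hm0 γ₂).ne']
  have hT2 : (m : ℝ) ^ c * Real.exp (-(1 / D₂)) ≤ 1 / 8 := hE2 (1 / D₂) hE₂ge
  -- conclude
  have : (m : ℝ) ^ c * (Real.exp (-E₁) + Real.exp (-(1 / D₂))) ≤ 1 / 4 := by
    rw [mul_add]; linarith
  simpa only [hE₁, hD₂, hL, hβ] using this

/-! ## The eventual form -/

/-- **The column-space LP slice of the crux holds for every `δ ∈ (0, 1/5)` and every `c`.** Eventually in `m`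
(`k = ⌈m^δ⌉₊`), for every `ε > 0`, every `R ≤ m^c`, all `b ≥ 0` and all `k`-clique-non-negative edge weightings `t₁,…,t_R`, the
identity `cdist Q u − ε = ∑_l b_l(u)·t_l(E(Q))` FAILS for some `k`-set `Q` and some `k`-clique-free `u`. [new] -/
theorem columnSpace_cliqueDistConeRankHard_fifth {δ : ℝ} (hδ0 : 0 < δ) (hδ1 : δ < 1 / 5) (c : ℕ) :
    ∀ᶠ m : ℕ in atTop, ∀ ε : ℝ, 0 < ε → ∀ R : ℕ, R ≤ m ^ c →
      ∀ (t : Fin R → Edge m → ℝ) (b : (Edge m → Bool) → Fin R → ℝ),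
      (∀ l (Q : Finset (Fin m)), Q.card = ⌈(m : ℝ) ^ δ⌉₊ → 0 ≤ ∑ e, if cliqueVec Q e = true then t l e else 0) →
      (∀ u l, 0 ≤ b u l) →
      ¬ ∀ (Q : Finset (Fin m)) (u : Edge m → Bool), Q.card = ⌈(m : ℝ) ^ δ⌉₊ → cliqueFn m ⌈(m : ℝ) ^ δ⌉₊ u = false →
          cdist Q u - ε = ∑ l, b u l * ∑ e, (if cliqueVec Q e = true then t l e else 0) := by
  filter_upwards [eventually_catch_exponent_two hδ0 hδ1 c] with m hm
  obtain ⟨hk4, hkm, hsmall⟩ := hm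
  intro ε hε R hR t b ht hb hall
  set k : ℕ := ⌈(m : ℝ) ^ δ⌉₊ with hk
  have hkm2 : k + 2 ≤ m := by omega
  set θ : ℝ := Real.exp (-(((m : ℝ) - 1) / (9216 * k * (2 * (k : ℝ) ^ 2 - 4 * k + 1) ^ 2))) +
    Real.exp (-(1 / (5200 * Real.sqrt (((k : ℝ) * (k - 1) / 2) * ((k - 2) / (m - k)))))) with hθ
  have hlb := restricted_terms_lower_bound_of_catch (by omega) hkm2 t ht b hb ε hε hall θ
    (fun w hw => by
      have h := card_badColourings_le_two hk4 hkm2 w hw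
      rw [hθ, mul_add]
      exact h)
  have hθ0 : 0 < θ := by rw [hθ]; positivity
  have hq3 : (3 : ℝ) ≤ ((k - 1 : ℕ) : ℝ) := by
    have : 3 ≤ k - 1 := by omega
    exact_mod_cast this
  set qm : ℝ := ((k - 1 : ℕ) : ℝ) ^ m with hqm
  have hqm0 : 0 < qm := by rw [hqm]; positivity
  have hq_le : ((k - 1 : ℕ) : ℝ) ≤ qm / 2 := by
    obtain ⟨m', hm'⟩ : ∃ m', m = m' + 2 := ⟨m - 2, by omega⟩
    rw [hqm, hm', pow_succ, pow_succ]
    have h1 : (1 : ℝ) ≤ ((k - 1 : ℕ) : ℝ) ^ m' := one_le_pow₀ (by linarith)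
    have hQ0 : (0 : ℝ) ≤ ((k - 1 : ℕ) : ℝ) := by positivity
    have h2 := mul_le_mul h1 hq3 (by norm_num) (by positivity)
    have h3 := mul_le_mul_of_nonneg_right h2 hQ0
    linarith
  have hRθ : (R : ℝ) * (qm * θ) ≤ qm / 4 := by
    have hR' : (R : ℝ) ≤ (m : ℝ) ^ c := by exact_mod_cast hR
    calc (R : ℝ) * (qm * θ) ≤ (m : ℝ) ^ c * (qm * θ) := mul_le_mul_of_nonneg_right hR' (by positivity)
      _ = qm * ((m : ℝ) ^ c * θ) := by ring
      _ ≤ qm * (1 / 4) := mul_le_mul_of_nonneg_left hsmall hqm0.le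
      _ = qm / 4 := by ring
  linarith

/-- **The column-space LP slice of the crux, every `δ < 1/5`** (registered form of
`columnSpace_cliqueDistConeRankHard_fifth`). [new] -/
theorem columnSpace_crux_fifth : ∀ (δ : ℝ), 0 < δ → δ < 1 / 5 → ∀ c : ℕ, ∀ᶠ m : ℕ in Filter.atTop, ∀ ε : ℝ, 0 < ε → ∀ R : ℕ, R ≤ m ^ c → ∀ (t : Fin R → Edge m → ℝ) (b : (Edge m → Bool) → Fin R → ℝ), (∀ l (Q : Finset (Fin m)), Q.card = ⌈(m : ℝ) ^ δ⌉₊ → 0 ≤ ∑ e, if cliqueVec Q e = true then t l e else 0) → (∀ u l, 0 ≤ b u l) → ¬ ∀ (Q : Finset (Fin m)) (u : Edge m → Bool), Q.card = ⌈(m : ℝ) ^ δ⌉₊ → cliqueFn m ⌈(m : ℝ) ^ δ⌉₊ u = false → cdist Q u - ε = ∑ l, b u l * ∑ e, (if cliqueVec Q e = true then t l e else 0) :=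
  fun _ hδ0 hδ1 c => columnSpace_cliqueDistConeRankHard_fifth hδ0 hδ1 c

end

end Summit.PneNP.PneNP.Theorems
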